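import Literature.NumberTheory.LFunctions.HermiteJensenRatioLemma
import Literature.NumberTheory.LFunctions.XiMomentRatioLog
import HarnessLib

/-!
# The Hermite–Jensen threshold law of `ξ` from shift `10⁵` (kernel rung K1 of the rh-jensen cell's P4)

**Theorem (RH-FREE; kernel, unconditional).** For every degree `d ≥ 2` and every shift `n ≥ 10⁵` with
`d³ · log⁸ n ≤ 2¹⁹ · (n + ½)⁴` — i.e. `n + ½ ≥ 2^{-19/4} · d^{3/4} · log² n` — O'Sullivan's Hermite–Jensen
polynomial `P^{d,n}_γ` of the Taylor coefficients `γ = xiTaylorCoeff` of `ξ` is hyperbolic, with `d`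
simple real zeros (`hermiteJensenThreshold_hundredThousand`, `hermiteJensenPoly_xi_splits`).

This is O'Sullivan's Thm. 1.3 (`P^{d,n}` hyperbolic for `n/log² n ≥ d^{3/4}/2`, `d ≥ d₀` INEFFECTIVE;
tree: the named fact `osullivan2021_thm1_3`) made effective in `d` (`d₀ = 2`, constant `2^{-19/4}`) from
the shift `10⁵` on: Turán's criterion for Hermite expansions (tree), the ratio lemma
`hermiteJensenCert_of_ratio` (`d³γ(n+1)⁴ ≤ 8γ(n)⁴` suffices for log-concave `γ > 0`), and the ONE
analytic input about `ξ`, the second-moment law `16·M_{2n+2} ≤ log² n·M_{2n}` of the Pólya–de Bruijn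
moments for `n ≥ 10⁵` (`xiMoment_ratio_le_log_sq`, Brascamp–Lieb).

PROVENANCE SPLIT (referee note J-n2, stated verbatim): the moment law is ZERO-FREE and HEIGHT-FREE
(`Φ`-side: `DeBruijnPhiLogConcave`, Coffey–Csordas 2013, and the `XiLadderMuTwo` chain); the
log-concavity of `γ` (Turán's inequalities `xiTaylorCoeff_mul_le_sq`) is HEIGHT-BOUGHT in the tree — it
descends from the kernel-certified Riemann hypothesis up to height `16` (`riemannHypothesisUpTo_sixteen`,
Backlund's certificate) through Kim–Lee's sector theorem (`jensenPoly_xiTaylorCoeff_splits_of_le`, `d ≤ 64`).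
So K1 is a KERNEL, UNCONDITIONAL theorem whose log-concavity input is certified-range, not zero-free; a
zero-free K1 would vendor Csordas–Norfolk–Varga 1986 for that input. By O'Sullivan's Cor. 3.8 the `P`-row
is cellwise weaker than the `J`-row; nothing here concerns zeros of `ζ` beyond height `16`, and nothing is
claimed about them.

## References
* [Osullivan2021] C. O'Sullivan, Res. Math. Sci. 8 (2021) 46, Thm. 1.3, (8.3).
* [BrascampLieb1976] Brascamp–Lieb, J. Funct. Anal. 22 (1976), Thm. 4.1.
-/

noncomputable section

open Polynomial

namespace Literature.NumberTheory.LFunctions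

/-- **Kernel rung K1: the Hermite–Jensen threshold law from shift `10⁵`** — for all `d ≥ 2`, `n ≥ 10⁵`
with `d³ log⁸ n ≤ 2¹⁹ (n + ½)⁴`, `P^{d,n}_ξ` is hyperbolic (RH-FREE). [cite: Osullivan2021, Thm. 1.3] -/
theorem hermiteJensenThreshold_hundredThousand : HermiteJensenThreshold 100000 :=
  hermiteJensenThreshold_of_momentLaw fun n hn => xiMoment_ratio_le_log_sq n hn

/-- The same, unfolded: `2 ≤ d → 10⁵ ≤ n → d³·log⁸ n ≤ 2¹⁹·(n + ½)⁴ → P^{d,n}_ξ(X/2)` splits over `ℝ`.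
[cite: Osullivan2021, Thm. 1.3] -/
theorem hermiteJensenPoly_xi_splits {d n : ℕ} (hd : 2 ≤ d) (hn : 100000 ≤ n)
    (h : (d : ℝ) ^ 3 * Real.log n ^ 8 ≤ 2 ^ 19 * ((n : ℝ) + 1 / 2) ^ 4) :
    (hermiteJensenPoly xiTaylorCoeff d n).Splits :=
  hermiteJensenThreshold_hundredThousand d n hd hn h

end Literature.NumberTheory.LFunctions
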